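import Mathlib
import HarnessLib
import Literature.Analysis.FluidPDE.AxisymmetricEuler
import Literature.Analysis.FluidPDE.SteadyNSSolution
import Literature.Analysis.FluidPDE.PolynomialFieldCertificates

/-!
# Route `PoloidalWindowDoor` (staged, nsreg-p1), crux `PoloidalWindowRigidity` (K2) — kernel certificate of the
# INFINITESIMAL NON-RIGIDITY of the poloidal stratum at the Hill-type base `U♭` (nsreg-p1 R9-PREP §(1), §7.2)

Cell ns-regularity-ideate, seat p7 (lead on K2). A NEGATIVE datum for the open stub `stub_nonflatLiouville`
(residue (G)): the «local rigidity conjecture» LRC (poloidal + rotational + non-flat ⟹ axisymmetric), whose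
Type-I-profile form would close K2, is NOT a first-order (linearised) consequence of
{steady Navier–Stokes, `ω₂ ≡ 0`} — so no proof of the residue by local differential algebra at first order exists
(census HOME/ns-regularity-ideate-p7/CENSUS-K2G.md §2 M6; nsreg-p1's mod-`p` rank computations j248684/j249096,
here replaced by an exact kernel computation over `ℚ`).

* `uFlat`, `pFlat` — the base `U♭ = (x(z+⅓), y(z+⅓), x²+y²−z²−⅔z)`, `P♭` (explicit quartic): a smooth STEADY
  Navier–Stokes solution on `ℝ³` (viscosity `1`, no force; `isSteadyNSSolution_uFlat`), divergence free, POLOIDAL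
  (`curl_uFlat_apply_two : (curl U♭)₂ = 0`) and AXISYMMETRIC about `e₂` (`isAxisymmetric_uFlat`); its
  vorticity `(x₁, −x₀, 0)` is linear, so the viscous term is inactive (`Δω ≡ 0`).
* `modeW`, `qW` — nsreg-p1's explicit mode-3 polynomial field `W = ∇φ₁ + ψ₁e₂` (velocity degree 5, pressure
  degree 7, exact rational coefficients) and the certificate that it solves the poloidal system LINEARISED at `U♭`:
  `(U♭·∇)W + (W·∇)U♭ + ∇q_W = ΔW`, `div W = 0`, `(curl W)₂ = 0` on all of `ℝ³` (`linearised_modeW`,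
  `divergence_modeW`, `curl_modeW_apply_two`).
* `not_isAxisymmetric_modeW_sub` — `W` is NOT axisymmetric modulo the symmetry-generated kernel: for all
  `α β : ℝ`, `W − α ∂ₓU♭ − β ∂_yU♭` is not axisymmetric about `e₂` (rotation by `π/2` at the point `(1,0,−⅓)`).
  (The remaining symmetry modes — `∂_zU♭`, scaling — are themselves axisymmetric.)

Method: all fields are polynomial; the bridge file `Literature/Analysis/FluidPDE/PolynomialFieldCertificates` (`polyField`, …) turns `convect`, `gradient`, `curl`,
`div`, `Δ` of polynomial fields into evaluations of formal partial derivatives (`Literature.Analysis.Calculus.MvPoly`,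
`…ValidatedNumerics.QMvPoly`), and each PDE identity becomes `normalize (residual term list) = []`, decided by the
kernel (`decide +kernel`, exact rational arithmetic; no `native_decide`).

WHAT THIS IS NOT: not a claim about Navier–Stokes regularity, not a refutation of K2 or of LRC (the datum is about
the LINEARISED equations at ONE unbounded polynomial flow outside the Type-I class; nsreg-p1 ROUND-10 shows the real
branch tangent to `W` is obstructed at third order) — kernel bookkeeping for a STAGED door route's open stub
(bears_on LADDER-NS N0, rung N0-LocalTubeDoorPoloidal).
-/

noncomputable section

-- the summit and its single sub-problem share the name (CONVENTIONS §1), as in every Theorems file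
set_option linter.dupNamespace false

namespace Summit.NavierStokesRegularity.NavierStokesRegularity.Theorems.PoloidalWindowDoorPoloidalWindowRigidityLinearNonrigidity

open scoped RealInnerProductSpace InnerProductSpace ContDiff Laplacian
open Literature.Analysis Literature.Analysis.FluidPDE
open Literature.Analysis.Calculus.MvPoly
open Literature.Analysis.ValidatedNumerics Literature.Analysis.ValidatedNumerics.QMvPoly
open Literature.Analysis.FluidPDE.PolyFieldCert

/-! ### The data (nsreg-p1 R9-PREP, `r9/deform.py`, base `(a,b,w) = (1,⅓,1)`; `W = V₁ − (2/81)∂ₓU♭`) -/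

/-- `U♭₀ = x₀(x₂ + ⅓)` as a term list (exponents of `x₀,x₁,x₂`, rational coefficient). -/
def uQ0 : QMvPoly := [([1, 0, 0], (1/3 : ℚ)), ([1, 0, 1], (1 : ℚ))]

/-- `U♭₁ = x₁(x₂ + ⅓)`. -/
def uQ1 : QMvPoly := [([0, 1, 0], (1/3 : ℚ)), ([0, 1, 1], (1 : ℚ))]

/-- `U♭₂ = x₀² + x₁² − x₂² − ⅔x₂`. -/
def uQ2 : QMvPoly := [([0, 0, 1], (-2/3 : ℚ)), ([0, 0, 2], (-1 : ℚ)), ([0, 2, 0], (1 : ℚ)), ([2, 0, 0], (1 : ℚ))]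

/-- `P♭ = −(x₀²+x₁²)²/4 − (x₀²+x₁²)/18 + 2ζ − ζ⁴/2 + ζ²/9`, `ζ = x₂+⅓` (expanded). -/
def pQ : QMvPoly := [([0, 0, 0], (109/162 : ℚ)), ([0, 0, 1], (2 : ℚ)), ([0, 0, 2], (-2/9 : ℚ)), ([0, 0, 3], (-2/3 : ℚ)), ([0, 0, 4], (-1/2 : ℚ)), ([0, 2, 0], (-1/18 : ℚ)), ([0, 4, 0], (-1/4 : ℚ)), ([2, 0, 0], (-1/18 : ℚ)), ([2, 2, 0], (-1/2 : ℚ)), ([4, 0, 0], (-1/4 : ℚ))]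

/-- `W₀` (nsreg-p1 `r9/deform.py`: `V1[0] − (2/81)(x₂+⅓)`). -/
def wQ0 : QMvPoly := [([0, 2, 0], (218/27 : ℚ)), ([0, 2, 1], (-2/3 : ℚ)), ([0, 2, 2], (-4 : ℚ)), ([0, 2, 3], (-4 : ℚ)), ([0, 4, 0], (1 : ℚ)), ([0, 4, 1], (3 : ℚ)), ([2, 0, 0], (-218/27 : ℚ)), ([2, 0, 1], (2/3 : ℚ)), ([2, 0, 2], (4 : ℚ)), ([2, 0, 3], (4 : ℚ)), ([2, 2, 0], (2 : ℚ)), ([2, 2, 1], (6 : ℚ)), ([4, 0, 0], (-5/3 : ℚ)), ([4, 0, 1], (-5 : ℚ))]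

/-- `W₁` (`= V1[1]`). -/
def wQ1 : QMvPoly := [([1, 1, 0], (436/27 : ℚ)), ([1, 1, 1], (-4/3 : ℚ)), ([1, 1, 2], (-8 : ℚ)), ([1, 1, 3], (-8 : ℚ)), ([1, 3, 0], (4 : ℚ)), ([1, 3, 1], (12 : ℚ)), ([3, 1, 0], (4/3 : ℚ)), ([3, 1, 1], (4 : ℚ))]

/-- `W₂` (`= V1[2] − (4/81)x₀`). -/
def wQ2 : QMvPoly := [([1, 2, 0], (-4/3 : ℚ)), ([1, 2, 1], (-16 : ℚ)), ([1, 2, 2], (-24 : ℚ)), ([1, 4, 0], (6 : ℚ)), ([3, 0, 0], (4/9 : ℚ)), ([3, 0, 1], (16/3 : ℚ)), ([3, 0, 2], (8 : ℚ)), ([3, 2, 0], (4 : ℚ)), ([5, 0, 0], (-2 : ℚ))]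

/-- `q_W = q1 + (2/81)(x₀³ + x₀x₁²) + (2/729)x₀` (pure mode 3). -/
def qQ : QMvPoly := [([1, 2, 0], (-2/27 : ℚ)), ([1, 4, 0], (-1 : ℚ)), ([1, 6, 0], (-3 : ℚ)), ([3, 0, 0], (2/81 : ℚ)), ([3, 2, 0], (-2/3 : ℚ)), ([3, 4, 0], (-5 : ℚ)), ([5, 0, 0], (1/3 : ℚ)), ([5, 2, 0], (-1 : ℚ)), ([7, 0, 0], (1 : ℚ))]

/-- `(∂ₓU♭)₀ = x₂ + ⅓`. -/
def txQ0 : QMvPoly := [([0, 0, 0], (1/3 : ℚ)), ([0, 0, 1], (1 : ℚ))]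

/-- `(∂ₓU♭)₁ = 0`. -/
def txQ1 : QMvPoly := []

/-- `(∂ₓU♭)₂ = 2x₀`. -/
def txQ2 : QMvPoly := [([1, 0, 0], (2 : ℚ))]

/-- `(∂_yU♭)₀ = 0`. -/
def tyQ0 : QMvPoly := []

/-- `(∂_yU♭)₁ = x₂ + ⅓`. -/
def tyQ1 : QMvPoly := [([0, 0, 0], (1/3 : ℚ)), ([0, 0, 1], (1 : ℚ))]

/-- `(∂_yU♭)₂ = 2x₁`. -/
def tyQ2 : QMvPoly := [([0, 1, 0], (2 : ℚ))]


/-- `U♭` as three term lists. -/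
def uQ : Fin 3 → QMvPoly := ![uQ0, uQ1, uQ2]
/-- `W` as three term lists. -/
def wQ : Fin 3 → QMvPoly := ![wQ0, wQ1, wQ2]
/-- `∂ₓU♭` as three term lists. -/
def txQ : Fin 3 → QMvPoly := ![txQ0, txQ1, txQ2]
/-- `∂_yU♭` as three term lists. -/
def tyQ : Fin 3 → QMvPoly := ![tyQ0, tyQ1, tyQ2]

/-- **The Hill-type base flow `U♭(x) = (x₀(x₂+⅓), x₁(x₂+⅓), x₀²+x₁²−x₂²−⅔x₂)`** (nsreg-p1's base A,
`(a,b,w) = (1,⅓,1)`): vorticity `(x₁, −x₀, 0)`. -/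
def uFlat : EuclideanSpace ℝ (Fin 3) → EuclideanSpace ℝ (Fin 3) := qField uQ
/-- Its pressure `P♭ = −(x₀²+x₁²)²/4 − (x₀²+x₁²)/18 + 2ζ − ζ⁴/2 + ζ²/9`, `ζ = x₂ + ⅓`. -/
def pFlat : EuclideanSpace ℝ (Fin 3) → ℝ := qScalar pQ
/-- **nsreg-p1's mode-3 field `W`** (polynomial of degree 5; `W = ∇φ₁ + ψ₁e₂` with
`ψ₁ = Re(x₀+ix₁)³·(4ζ² − r² − 2/9)`-type factors). -/
def modeW : EuclideanSpace ℝ (Fin 3) → EuclideanSpace ℝ (Fin 3) := qField wQ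
/-- Its linearised pressure `q_W` (degree 7, pure azimuthal mode 3). -/
def qW : EuclideanSpace ℝ (Fin 3) → ℝ := qScalar qQ
/-- The translation mode `∂ₓU♭ = (ζ, 0, 2x₀)`. -/
def transX : EuclideanSpace ℝ (Fin 3) → EuclideanSpace ℝ (Fin 3) := qField txQ
/-- The translation mode `∂_yU♭ = (0, ζ, 2x₁)`. -/
def transY : EuclideanSpace ℝ (Fin 3) → EuclideanSpace ℝ (Fin 3) := qField tyQ

/-! ### Kernel certificates (exact rational arithmetic, `decide +kernel`) -/

/-- `U♭` solves steady NS with pressure `P♭` (term-list certificate). -/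
theorem cert_ns_uQ : ∀ i : Fin 3, normalize (nsResQ uQ pQ i) = [] := by decide +kernel
/-- `div U♭ = 0` (certificate). -/
theorem cert_div_uQ : normalize (divQ uQ) = [] := by decide +kernel
/-- `(curl U♭)₂ = 0` (certificate). -/
theorem cert_curl2_uQ : normalize (curl2Q uQ) = [] := by decide +kernel
/-- `W` solves the system linearised at `U♭` with pressure `q_W` (certificate). -/
theorem cert_lin_wQ : ∀ i : Fin 3, normalize (linResQ uQ wQ qQ i) = [] := by decide +kernel
/-- `div W = 0` (certificate). -/
theorem cert_div_wQ : normalize (divQ wQ) = [] := by decide +kernel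
/-- `(curl W)₂ = 0` (certificate). -/
theorem cert_curl2_wQ : normalize (curl2Q wQ) = [] := by decide +kernel
/-- `∂ₓU♭ = transX` (certificate). -/
theorem cert_tx : ∀ i : Fin 3, normalize (pderivQ (0 : Fin 3) (uQ i) ++ smul (-1) (txQ i)) = [] := by
  decide +kernel
/-- `∂_yU♭ = transY` (certificate). -/
theorem cert_ty : ∀ i : Fin 3, normalize (pderivQ (1 : Fin 3) (uQ i) ++ smul (-1) (tyQ i)) = [] := by
  decide +kernel
/-- The translation modes solve the linearised system with pressures `∂ₓP♭`, `∂_yP♭` (certificate). -/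
theorem cert_lin_txQ : ∀ i : Fin 3, normalize (linResQ uQ txQ (pderivQ 0 pQ) i) = [] := by decide +kernel
/-- (certificate) -/
theorem cert_lin_tyQ : ∀ i : Fin 3, normalize (linResQ uQ tyQ (pderivQ 1 pQ) i) = [] := by decide +kernel

/-! ### The theorems -/

/-- `U♭` and `P♭` are smooth. -/
theorem contDiff_uFlat {m : WithTop ℕ∞} : ContDiff ℝ m uFlat := contDiff_polyField _

/-- **`U♭` is a steady Navier–Stokes solution on `ℝ³`** (viscosity `1`, no force): `(U♭·∇)U♭ + ∇P♭ = ΔU♭`. -/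
theorem uFlat_momentum (x : EuclideanSpace ℝ (Fin 3)) :
    convect uFlat uFlat x + gradient pFlat x = (Δ uFlat) x :=
  steadyNS_of_cert uQ pQ cert_ns_uQ x

/-- `div U♭ = 0`. -/
theorem divergence_uFlat (x : EuclideanSpace ℝ (Fin 3)) : VectorCalculus.divergence uFlat x = 0 :=
  divergence_of_cert uQ cert_div_uQ x

/-- **`U♭` is poloidal**: `(curl U♭)₂ = 0`. -/
theorem curl_uFlat_apply_two (x : EuclideanSpace ℝ (Fin 3)) : curl uFlat x 2 = 0 :=
  curl_two_of_cert uQ cert_curl2_uQ x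

/-- `U♭₀(x) = x₀(x₂ + ⅓)`. -/
theorem uFlat_apply_zero (x : EuclideanSpace ℝ (Fin 3)) : uFlat x 0 = x 0 * (x 2 + 1 / 3) := by
  rw [uFlat, qField, polyField_apply]
  simp only [uQ, Matrix.cons_val_zero]
  rw [toFun_mv_eq_sum]
  simp [uQ0, Fin.prod_univ_three, List.getD]
  ring

/-- `U♭₁(x) = x₁(x₂ + ⅓)`. -/
theorem uFlat_apply_one (x : EuclideanSpace ℝ (Fin 3)) : uFlat x 1 = x 1 * (x 2 + 1 / 3) := by
  rw [uFlat, qField, polyField_apply]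
  simp only [uQ, Matrix.cons_val_one, Matrix.cons_val_zero]
  rw [toFun_mv_eq_sum]
  simp [uQ1, Fin.prod_univ_three, List.getD]
  ring

/-- `U♭₂(x) = x₀² + x₁² − x₂² − ⅔x₂`. -/
theorem uFlat_apply_two (x : EuclideanSpace ℝ (Fin 3)) :
    uFlat x 2 = x 0 ^ 2 + x 1 ^ 2 - x 2 ^ 2 - 2 / 3 * x 2 := by
  rw [uFlat, qField, polyField_apply]
  simp only [uQ, Matrix.cons_val_two, Matrix.tail_cons, Matrix.head_cons]
  rw [toFun_mv_eq_sum]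
  simp [uQ2, Fin.prod_univ_three, List.getD]
  ring

/-- **`U♭` is axisymmetric about the vertical axis** (`U♭(R_θ x) = R_θ U♭(x)` for all rotations about `e₂`). -/
theorem isAxisymmetric_uFlat : IsAxisymmetric uFlat := by
  intro θ x
  have hc := Real.cos_sq_add_sin_sq θ
  ext i
  fin_cases i
  · show uFlat (rotZ θ x) 0 = rotZ θ (uFlat x) 0
    rw [rotZ_apply_zero, uFlat_apply_zero, uFlat_apply_zero, uFlat_apply_one, rotZ_apply_zero, rotZ_apply_two]
    ring
  · show uFlat (rotZ θ x) 1 = rotZ θ (uFlat x) 1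
    rw [rotZ_apply_one, uFlat_apply_one, uFlat_apply_zero, uFlat_apply_one, rotZ_apply_one, rotZ_apply_two]
    ring
  · show uFlat (rotZ θ x) 2 = rotZ θ (uFlat x) 2
    rw [rotZ_apply_two, uFlat_apply_two, uFlat_apply_two, rotZ_apply_zero, rotZ_apply_one, rotZ_apply_two]
    linear_combination (x 0 ^ 2 + x 1 ^ 2) * hc

/-- `U♭, P♭` packaged as a steady Navier–Stokes solution in the tree's sense (`ν = 1`, `f = 0`). -/
theorem isSteadyNSSolution_uFlat : IsSteadyNSSolution 1 0 uFlat pFlat where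
  contDiff_velocity := contDiff_polyField _
  contDiff_pressure := contDiff_toFun _
  momentum := fun y => by
    rw [one_smul, ← uFlat_momentum y]
    simp
  divFree := divergence_uFlat

/-- **`W` solves the poloidal system linearised at `U♭`** — momentum part:
`(U♭·∇)W + (W·∇)U♭ + ∇q_W = ΔW` on `ℝ³`. -/
theorem linearised_modeW (x : EuclideanSpace ℝ (Fin 3)) :
    convect uFlat modeW x + convect modeW uFlat x + gradient qW x = (Δ modeW) x :=
  linearised_of_cert uQ wQ qQ cert_lin_wQ x

/-- `div W = 0`. -/
theorem divergence_modeW (x : EuclideanSpace ℝ (Fin 3)) : VectorCalculus.divergence modeW x = 0 :=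
  divergence_of_cert wQ cert_div_wQ x

/-- **`W` is poloidal to first order**: `(curl W)₂ = 0`. -/
theorem curl_modeW_apply_two (x : EuclideanSpace ℝ (Fin 3)) : curl modeW x 2 = 0 :=
  curl_two_of_cert wQ cert_curl2_wQ x

/-- `transX = ∂ₓU♭`. -/
theorem fderiv_uFlat_single_zero (x : EuclideanSpace ℝ (Fin 3)) :
    fderiv ℝ uFlat x (EuclideanSpace.single 0 1) = transX x :=
  fderiv_single_of_cert uQ txQ 0 cert_tx x

/-- `transY = ∂_yU♭`. -/
theorem fderiv_uFlat_single_one (x : EuclideanSpace ℝ (Fin 3)) :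
    fderiv ℝ uFlat x (EuclideanSpace.single 1 1) = transY x :=
  fderiv_single_of_cert uQ tyQ 1 cert_ty x

/-- The translation modes are in the kernel of the linearised operator (with pressures `∂ₓP♭`, `∂_yP♭`). -/
theorem linearised_transX (x : EuclideanSpace ℝ (Fin 3)) :
    convect uFlat transX x + convect transX uFlat x + gradient (qScalar (pderivQ 0 pQ)) x = (Δ transX) x :=
  linearised_of_cert uQ txQ _ cert_lin_txQ x

/-- (the second translation mode) -/
theorem linearised_transY (x : EuclideanSpace ℝ (Fin 3)) :
    convect uFlat transY x + convect transY uFlat x + gradient (qScalar (pderivQ 1 pQ)) x = (Δ transY) x :=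
  linearised_of_cert uQ tyQ _ cert_lin_tyQ x

/-! ### `W` is not axisymmetric, even modulo the translation modes -/

/-- The test point `(1, 0, −⅓)` and its image `(0, 1, −⅓)` under the rotation by `π/2` about `e₂`. -/
theorem rotZ_pi_div_two_testPoint :
    rotZ (Real.pi / 2) (WithLp.toLp 2 ![1, 0, -1/3] : EuclideanSpace ℝ (Fin 3)) = WithLp.toLp 2 ![0, 1, -1/3] := by
  ext i
  fin_cases i <;> simp [rotZ, Real.cos_pi_div_two, Real.sin_pi_div_two]

/-- Point values: `W₀(0,1,−⅓) = 8`. -/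
theorem modeW_apply_zero_at : modeW (WithLp.toLp 2 ![0, 1, -1/3]) 0 = 8 := by
  rw [modeW, qField, polyField_apply]
  simp only [wQ, Matrix.cons_val_zero]
  rw [toFun_mv_eq_sum]
  simp [wQ0, Fin.prod_univ_three, List.getD]
  norm_num

/-- Point values: `W₁(1,0,−⅓) = 0`. -/
theorem modeW_apply_one_at : modeW (WithLp.toLp 2 ![1, 0, -1/3]) 1 = 0 := by
  rw [modeW, qField, polyField_apply]
  simp only [wQ, Matrix.cons_val_one, Matrix.cons_val_zero]
  rw [toFun_mv_eq_sum]
  simp [wQ1, Fin.prod_univ_three, List.getD]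

/-- `(∂ₓU♭)₀ (0,1,−⅓) = 0`. -/
theorem transX_apply_zero_at : transX (WithLp.toLp 2 ![0, 1, -1/3]) 0 = 0 := by
  rw [transX, qField, polyField_apply]
  simp only [txQ, Matrix.cons_val_zero]
  rw [toFun_mv_eq_sum]
  simp [txQ0, Fin.prod_univ_three, List.getD]
  norm_num

/-- `(∂_yU♭)₀ (0,1,−⅓) = 0`. -/
theorem transY_apply_zero_at : transY (WithLp.toLp 2 ![0, 1, -1/3]) 0 = 0 := by
  rw [transY, qField, polyField_apply]
  simp only [tyQ, Matrix.cons_val_zero]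
  rw [toFun_mv_eq_sum]
  simp [tyQ0]

/-- `(∂ₓU♭)₁ (1,0,−⅓) = 0`. -/
theorem transX_apply_one_at : transX (WithLp.toLp 2 ![1, 0, -1/3]) 1 = 0 := by
  rw [transX, qField, polyField_apply]
  simp only [txQ, Matrix.cons_val_one, Matrix.cons_val_zero]
  rw [toFun_mv_eq_sum]
  simp [txQ1]

/-- `(∂_yU♭)₁ (1,0,−⅓) = 0`. -/
theorem transY_apply_one_at : transY (WithLp.toLp 2 ![1, 0, -1/3]) 1 = 0 := by
  rw [transY, qField, polyField_apply]
  simp only [tyQ, Matrix.cons_val_one, Matrix.cons_val_zero]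
  rw [toFun_mv_eq_sum]
  simp [tyQ1, Fin.prod_univ_three, List.getD]
  norm_num

/-- **Infinitesimal non-rigidity of the poloidal stratum at `U♭`.** The linearised solution `W` is not
axisymmetric about the vertical axis, even after subtracting any combination of the horizontal translation modes
`∂ₓU♭, ∂_yU♭` (the other symmetry modes, `∂_zU♭` and scaling, are axisymmetric): for all `α β`,
`W − α ∂ₓU♭ − β ∂_yU♭` is not `IsAxisymmetric`. Witness: rotation by `π/2` at `(1,0,−⅓)`, component `0`
(`8 ≠ 0`). So LRC is not a first-order consequence of {steady NS, `ω₂ ≡ 0`} at `U♭` (nsreg-p1 R9-PREP §(1)). -/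
theorem not_isAxisymmetric_modeW_sub (α β : ℝ) :
    ¬ IsAxisymmetric (fun x => modeW x - α • transX x - β • transY x) := by
  intro h
  have h1 := congrArg (fun v : EuclideanSpace ℝ (Fin 3) => v 0)
    (h (Real.pi / 2) (WithLp.toLp 2 ![1, 0, -1/3] : EuclideanSpace ℝ (Fin 3)))
  simp only [rotZ_pi_div_two_testPoint] at h1
  have lhs : (modeW (WithLp.toLp 2 ![0, 1, -1/3]) - α • transX (WithLp.toLp 2 ![0, 1, -1/3]) -
      β • transY (WithLp.toLp 2 ![0, 1, -1/3])) 0 = 8 := by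
    simp only [PiLp.sub_apply, PiLp.smul_apply, smul_eq_mul, modeW_apply_zero_at, transX_apply_zero_at,
      transY_apply_zero_at, mul_zero, sub_zero]
  have rhs : (rotZ (Real.pi / 2) (modeW (WithLp.toLp 2 ![1, 0, -1/3]) - α • transX (WithLp.toLp 2 ![1, 0, -1/3]) -
      β • transY (WithLp.toLp 2 ![1, 0, -1/3]))) 0 = 0 := by
    simp only [rotZ_apply_zero, Real.cos_pi_div_two, Real.sin_pi_div_two, PiLp.sub_apply, PiLp.smul_apply,
      smul_eq_mul, modeW_apply_one_at, transX_apply_one_at, transY_apply_one_at, mul_zero, zero_mul, sub_self]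
  rw [lhs, rhs] at h1
  norm_num at h1

end Summit.NavierStokesRegularity.NavierStokesRegularity.Theorems.PoloidalWindowDoorPoloidalWindowRigidityLinearNonrigidity

end
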